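import Literature.NumberTheory.ComplexMultiplication.CMTypeRankPartitionSlots
import Literature.NumberTheory.ComplexMultiplication.CMTypeRankFixedVectorCriteria
import Literature.NumberTheory.ComplexMultiplication.CMTypeRankIrreducibleSlot
import Literature.AlgebraicGeometry.Pohlmann1968.CMFamilyRankPartition
import HarnessLib

/-!
# Nondegeneracy of a family of CM types is decided on the blocks of a partition as soon as no two SLOTS of different
# blocks share a constituent; an irreducible slot whose Galois closure escapes another slot's shares nothing with it

Family `hodge`, layer `Literature/AlgebraicGeometry/Pohlmann1968`; KERNEL ONLY (theorems; no definition, no named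
fact, no `sorry`).  Number-field dress of `NumberTheory/ComplexMultiplication/CMTypeRankPartitionSlots` (the slot
criterion ACROSS the blocks of `κ : I → C` gives the block criterion of `…/CMTypeRankPartition`) and of criterion (κ) of
`…/CMTypeRankFixedVectorCriteria`, for `G = Aut(ℂ)` acting on `⊔_i Hom(K_i, ℂ)`, in the vocabulary of
`Pohlmann1968/NondegenerateCMAlgebraTypes` (`CMAlgebra.cmFamilyRank`, `CMAlgebra.IsNondegenerateFamily`) and
`Pohlmann1968/CMFamilyRankPartition` (seat p2: blocks nondegenerate ⟸⟹ family nondegenerate, under partial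
conjugations between blocks).  Cell `pub-hodgecm2` (COR-CM), count-neutral own lane (seat b16); HONEST FRAMING: an
unconditional structure theorem on Mumford–Tate groups of CM abelian varieties, not a step of the summit chain.

* `cmFamilyRank_add_card_eq_of_pairwise_slots_fiber`, **`isNondegenerateFamily_iff_forall_fiber_of_pairwise_slots`** —
  for any `κ : I ↠ C`: if for all slots `i, j` with `κ i ≠ κ j` the `Aut(ℂ)`-modules `U(Φ_i)`, `U(Φ_j)` have no common
  constituent, then `rank((Φ_i)_i) + |C| = Σ_c rank((Φ_i)_{κ i = c}) + 1` and `(Φ_i)_i` is nondegenerate iff every block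
  sub-family is — `Hg(∏_i A_i) = ∏_c Hg(∏_{κ i = c} A_i)`, with NOTHING asked of two slots in the same block and nothing
  asked of the Galois closures of different blocks (they may share imaginary quadratic subfields);
* `exists_ringEquiv_apply_ne_of_not_mem` — Galois correspondence for `Aut(ℂ)`: an algebraic `x ∉ M` (`M ≤ ℂ` of finite
  degree) is moved by an automorphism of `ℂ` fixing `M` pointwise;
* **`pairwise_of_irreducible_of_not_normalClosure_le`** — criterion (κ) for CM fields: if `Φ_i` is nondegenerate with
  `U(Φ_i)` IRREDUCIBLE (e.g. `K_i` with pair flips: `irreducible_of_pairFlip`) and the Galois closure of `K_i` in `ℂ` is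
  NOT contained in that of `K_j`, then `U(Φ_i)`, `U(Φ_j)` have no common constituent, in both orders — whatever `Φ_j`
  is, and however the two closures meet (`pairwise_of_irreducible_of_lt_finrank_normalClosure`: it suffices that
  `[L_j : ℚ] < [L_i : ℚ]`).

## References
* [MoonenZarhin1999LowDim] B. Moonen, Yu. Zarhin, Math. Ann. 315 (1999) 711–733, §3 (3.1), (3.9).
* [Gordon1999HodgeAVSurvey] B. B. Gordon, *A survey of the Hodge conjecture for abelian varieties*, §3 Theorem (Imai,
  Murty) with proof; 7.5–7.7.
* [Lang2002] S. Lang, *Algebra*, GTM 211, VI §1 Thm. 1.1, Cor. 1.6; V §2 Thm. 2.8.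
* [Dodson1984] B. Dodson, *The structure of Galois groups of CM-fields*, Trans. AMS 283 (1984), §5.1.
-/

noncomputable section

open scoped BigOperators
open IntermediateField NumberField

/-! ### §1 Galois correspondence for `Aut(ℂ)`: moving an element outside a subfield -/

namespace Literature.NumberTheory.ComplexMultiplication

section Move

/-- A finite-dimensional intermediate field of `ℂ/ℚ` is countable. [folklore] -/
private theorem countable_of_finiteDimensional₄₃ (C : IntermediateField ℚ ℂ) [FiniteDimensional ℚ C] :
    Countable C :=
  Countable.of_equiv _ (Module.finBasis ℚ C).equivFun.toEquiv.symm

/-- **An element of finite degree outside `M` is moved by an automorphism of `ℂ` fixing `M` pointwise** (`M`, `N`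
intermediate fields of `ℂ/ℚ` of finite degree, `x ∈ N`, `x ∉ M`): in the normal closure `C` of `M N`, `M` is the fixed
field of `Gal(C/M)`, so some `γ ∈ Gal(C/M)` moves `x`, and `γ` extends to `ℂ`. [cite: Lang2002, VI §1 Thm. 1.1 and Cor. 1.6] -/
theorem exists_ringEquiv_apply_ne_of_not_mem {M N : IntermediateField ℚ ℂ} [FiniteDimensional ℚ M]
    [FiniteDimensional ℚ N] {x : ℂ} (hxN : x ∈ N) (hxM : x ∉ M) :
    ∃ τ : ℂ ≃+* ℂ, (∀ y : ℂ, y ∈ M → τ y = y) ∧ τ x ≠ x := by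
  classical
  letI iMN : Algebra ℚ ↥(M ⊔ N) := IntermediateField.algebra' _
  let C : IntermediateField ℚ ℂ := normalClosure ℚ ↥(M ⊔ N) ℂ
  letI iC : Algebra ℚ ↥C := IntermediateField.algebra' C
  have hMC : M ≤ C := (le_sup_left : M ≤ M ⊔ N).trans (IntermediateField.le_normalClosure _)
  have hNC : N ≤ C := (le_sup_right : N ≤ M ⊔ N).trans (IntermediateField.le_normalClosure _)
  haveI : Normal ℚ ↥C := by
    haveI := Algebra.IsAlgebraic.isNormalClosure_normalClosure (F := ℚ) (K := ↥(M ⊔ N)) (L := ℂ)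
      fun x => IsAlgClosed.splits _
    exact IsNormalClosure.normal (K := ↥(M ⊔ N))
  haveI : Algebra.IsSeparable ℚ (↥C) := Algebra.IsAlgebraic.isSeparable_of_perfectField
  haveI : IsGalois ℚ (↥C) := ⟨⟩
  haveI : Countable ↥C := countable_of_finiteDimensional₄₃ C
  let M' : IntermediateField ℚ ↥C := IntermediateField.restrict hMC
  have hxC : x ∈ C := hNC hxN
  -- `x ∉ M' = fixedField (Gal(C/M'))`: some `γ ∈ Gal(C/M')` moves `x`
  have hex : ∃ γ ∈ M'.fixingSubgroup, γ ⟨x, hxC⟩ ≠ ⟨x, hxC⟩ := by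
    by_contra hall
    push Not at hall
    have hmem : (⟨x, hxC⟩ : ↥C) ∈ IntermediateField.fixedField M'.fixingSubgroup :=
      (IntermediateField.mem_fixedField_iff _ _).2 fun γ hγ => hall γ hγ
    rw [IsGalois.fixedField_fixingSubgroup] at hmem
    exact hxM ((IntermediateField.mem_restrict hMC _).1 hmem)
  obtain ⟨γ, hγ, hγx⟩ := hex
  -- extend `γ` to `ℂ`
  obtain ⟨τ, hτ⟩ := Literature.AlgebraicGeometry.Motives.ZarhinLie.exists_ringEquiv_complex_comp_eq
    (algebraMap (↥C) ℂ) ((algebraMap (↥C) ℂ).comp γ.toRingEquiv.toRingHom)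
  have hτC : ∀ z : ↥C, τ (z : ℂ) = ((γ z : ↥C) : ℂ) := fun z => hτ z
  refine ⟨τ, fun y hy => ?_, fun hx => hγx ?_⟩
  · have e := (IntermediateField.mem_fixingSubgroup_iff _ _).1 hγ ⟨y, hMC hy⟩
      ((IntermediateField.mem_restrict hMC _).2 hy)
    rw [hτC ⟨y, hMC hy⟩, e]
  · apply Subtype.ext
    have e := hτC ⟨x, hxC⟩
    rw [hx] at e
    exact e.symm

end Move

/-! ### §2 Criterion (κ) for CM fields: an irreducible slot whose Galois closure is not inside the other one's -/

section Kappa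

open Literature.AlgebraicGeometry.Pohlmann1968
open Literature.AlgebraicGeometry.Motives (CMType)

variable {I : Type} {K : I → Type} [∀ i, Field (K i)] [∀ i, NumberField (K i)]

/-- The image of an embedding of a number field is finite over `ℚ`. [folklore] -/
private theorem finiteDimensional_fieldRange₄₃ {F : Type} [Field F] [NumberField F] (f : F →ₐ[ℚ] ℂ) :
    FiniteDimensional ℚ f.fieldRange :=
  LinearEquiv.finiteDimensional (AlgEquiv.ofInjectiveField f).toLinearEquiv

/-- **If `L_i ⊄ L_j` then some automorphism of `ℂ` fixes every embedding of `K_j` and moves an embedding of `K_i`**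
(`L = normalClosure ℚ K ℂ`, the compositum of the images of all embeddings). [cite: Lang2002, VI §1 Thm. 1.1 and Cor. 1.6] -/
theorem exists_ringEquiv_smul_eq_and_smul_ne {i j : I}
    (hL : ¬ normalClosure ℚ (K i) ℂ ≤ normalClosure ℚ (K j) ℂ) :
    ∃ τ : ℂ ≃+* ℂ, (∀ t : K j →+* ℂ, τ • t = t) ∧ ∃ s : K i →+* ℂ, τ • s ≠ s := by
  obtain ⟨f, hf⟩ : ∃ f : K i →ₐ[ℚ] ℂ, ¬ f.fieldRange ≤ normalClosure ℚ (K j) ℂ := by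
    by_contra hall
    push Not at hall
    exact hL (normalClosure_le_iff.2 hall)
  obtain ⟨y, hyf, hyL⟩ : ∃ y, y ∈ f.fieldRange ∧ y ∉ normalClosure ℚ (K j) ℂ := by
    by_contra hall
    push Not at hall
    exact hf fun y hy => hall y hy
  haveI := finiteDimensional_fieldRange₄₃ f
  obtain ⟨τ, hτM, hτy⟩ := exists_ringEquiv_apply_ne_of_not_mem hyf hyL
  refine ⟨τ, fun t => RingHom.ext fun x => ?_, f.toRingHom, fun h => hτy ?_⟩
  · rw [ringEquiv_smul_apply]
    exact hτM _ (apply_mem_normalClosure j t x)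
  · obtain ⟨x, rfl⟩ := AlgHom.mem_fieldRange.1 hyf
    have e := RingHom.congr_fun h x
    rw [ringEquiv_smul_apply] at e
    exact e

/-- **Criterion (κ) for CM fields.**  If `Φ_i` is nondegenerate, `U(Φ_i)` is IRREDUCIBLE, and the Galois closure of `K_i`
in `ℂ` is NOT contained in that of `K_j`, then `U(Φ_i)` and `U(Φ_j)` have no common constituent, in both orders: an
automorphism `τ` of `ℂ` trivial on `L_j` with `τ ∘ s ≠ s` moves the odd vector `δ_s − δ_{s̄} ∈ Anti = U(Φ_i)`.
[cite: Gordon1999HodgeAVSurvey, §3 Theorem (proof)] [cite: Lang2002, VI §1 Cor. 1.6] -/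
theorem pairwise_of_irreducible_of_not_normalClosure_le [∀ i, IsCMField (K i)] {Φ : ∀ i, CMType (K i)} {i j : I}
    (hirr : ∀ W : Submodule ℚ ((K i →+* ℂ) → ℚ), W ≤ antiSpan (ℂ ≃+* ℂ) (Φ i).1 → W ≠ ⊥ →
      (∀ (g : ℂ ≃+* ℂ) (f : (K i →+* ℂ) → ℚ), f ∈ W → (fun y => f (g • y)) ∈ W) →
        W = antiSpan (ℂ ≃+* ℂ) (Φ i).1)
    (hnd : IsNondegenerate (Φ i)) (hL : ¬ normalClosure ℚ (K i) ℂ ≤ normalClosure ℚ (K j) ℂ) :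
    (∀ P : Submodule ℚ ((K i →+* ℂ) → ℚ), P ≤ antiSpan (ℂ ≃+* ℂ) (Φ i).1 →
      (∀ g : ℂ ≃+* ℂ, ∀ f ∈ P, (fun x => f (g • x)) ∈ P) →
      ∀ T : ((K i →+* ℂ) → ℚ) →ₗ[ℚ] ((K j →+* ℂ) → ℚ),
        (∀ g : ℂ ≃+* ℂ, ∀ f ∈ P, T (fun x => f (g • x)) = fun y => T f (g • y)) →
        (∀ f ∈ P, T f ∈ antiSpan (ℂ ≃+* ℂ) (Φ j).1) → (∀ f ∈ P, T f = 0 → f = 0) → P = ⊥) ∧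
    (∀ P : Submodule ℚ ((K j →+* ℂ) → ℚ), P ≤ antiSpan (ℂ ≃+* ℂ) (Φ j).1 →
      (∀ g : ℂ ≃+* ℂ, ∀ f ∈ P, (fun x => f (g • x)) ∈ P) →
      ∀ T : ((K j →+* ℂ) → ℚ) →ₗ[ℚ] ((K i →+* ℂ) → ℚ),
        (∀ g : ℂ ≃+* ℂ, ∀ f ∈ P, T (fun x => f (g • x)) = fun y => T f (g • y)) →
        (∀ f ∈ P, T f ∈ antiSpan (ℂ ≃+* ℂ) (Φ i).1) → (∀ f ∈ P, T f = 0 → f = 0) → P = ⊥) := by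
  classical
  obtain ⟨τ, hτj, s, hτs⟩ := exists_ringEquiv_smul_eq_and_smul_ne (K := K) (i := i) (j := j) hL
  refine pairwise_of_irreducible_of_smul_eq (G := ℂ ≃+* ℂ) (Φ := fun i => (Φ i).1) hirr hτj ?_
  -- the witness `δ_s − δ_{s̄} ∈ Anti = U(Φ_i)`, moved by `τ`
  set ρ : ℂ ≃+* ℂ := starRingAut
  have hU : antiSpan (ℂ ≃+* ℂ) (Φ i).1 = antiWeights (E := K i →+* ℂ) ρ := by
    refine (isCMTypeWith_conj (Φ i)).typeRank_eq_iff_antiSpan_eq.1 ?_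
    rw [Embeddings.card]
    exact hnd
  refine ⟨Pi.single s (1 : ℚ) - Pi.single (ρ • s) 1, ?_, fun heq => ?_⟩
  · rw [hU]
    exact single_sub_single_mem_antiWeights (isCMTypeWith_conj (Φ i)).invol s
  · have hτ's : τ⁻¹ • s ≠ s := fun h => hτs (by rw [← h, smul_inv_smul]; exact h.symm ▸ rfl)
    have e := congrFun heq (τ⁻¹ • s)
    simp only [smul_inv_smul, Pi.sub_apply, Pi.single_apply] at e
    rw [if_neg ((isCMTypeWith_conj (Φ i)).rho_smul_ne s).symm, if_neg hτ's] at e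
    by_cases h2 : τ⁻¹ • s = ρ • s
    · rw [if_pos h2] at e; norm_num at e
    · rw [if_neg h2] at e; norm_num at e

/-- The Galois closure of a larger degree is not contained in the one of smaller degree (`[L_j : ℚ] < [L_i : ℚ] ⟹
L_i ⊄ L_j`; degrees are monotone along inclusions, tower law). [cite: Lang2002, V §1 Prop. 1.2] -/
theorem not_normalClosure_le_of_lt_finrank {i j : I}
    (hlt : Module.finrank ℚ (normalClosure ℚ (K j) ℂ) < Module.finrank ℚ (normalClosure ℚ (K i) ℂ)) :
    ¬ normalClosure ℚ (K i) ℂ ≤ normalClosure ℚ (K j) ℂ := fun hle =>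
  absurd (IntermediateField.finrank_le_of_le_right hle) (not_le.2 hlt)

/-- Two DIFFERENT Galois closures of the same degree are not contained in one another (an inclusion of fields of equal
finite degree is an equality, tower law). [cite: Lang2002, V §1 Prop. 1.2] -/
theorem not_normalClosure_le_of_ne_of_finrank_eq {i j : I}
    (hne : normalClosure ℚ (K i) ℂ ≠ normalClosure ℚ (K j) ℂ)
    (heq : Module.finrank ℚ (normalClosure ℚ (K i) ℂ) = Module.finrank ℚ (normalClosure ℚ (K j) ℂ)) :
    ¬ normalClosure ℚ (K i) ℂ ≤ normalClosure ℚ (K j) ℂ := fun hle =>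
  hne (IntermediateField.eq_of_le_of_finrank_eq hle heq)

end Kappa

end Literature.NumberTheory.ComplexMultiplication

/-! ### §3 The CM dress: nondegeneracy along a partition from the slot criterion across blocks -/

namespace Literature.AlgebraicGeometry.Pohlmann1968

namespace CMAlgebra

open Literature.NumberTheory.ComplexMultiplication
open Literature.AlgebraicGeometry.Motives (CMType)

variable {I : Type} {K : I → Type} [∀ i, Field (K i)] [∀ i, NumberField (K i)] [∀ i, IsCMField (K i)]
  [Fintype I] {C : Type} [Fintype C] [DecidableEq C]

omit [∀ i, IsCMField (K i)] in
/-- `|⊔_i Hom(K_i, ℂ)| = Σ_i [K_i : ℚ]`. [folklore] -/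
private theorem card_sigma_ringHom_eq_sum_finrank₄₃ :
    Fintype.card ((i : I) × (K i →+* ℂ)) = ∑ i, Module.finrank ℚ (K i) := by
  rw [Fintype.card_sigma]
  exact Finset.sum_congr rfl fun i _ => Embeddings.card (K i) ℂ

/-- **Rank additivity over the blocks from the slot criterion across blocks**: for a surjection `κ : I → C`, if no
two slots of different blocks share a constituent then `rank((Φ_i)_i) + |C| = Σ_c rank((Φ_i)_{κ i = c}) + 1`
(`Hg(∏_i A_i) = ∏_c Hg(∏_{κ i = c} A_i)`). [cite: MoonenZarhin1999LowDim, §3 (3.1)] [cite: Gordon1999HodgeAVSurvey, §3 Theorem (1)] -/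
theorem cmFamilyRank_add_card_eq_of_pairwise_slots_fiber [Nonempty I] (Φ : ∀ i, CMType (K i)) (κ : I → C)
    (hκ : Function.Surjective κ)
    (hpair : ∀ i j, κ i ≠ κ j → ∀ P : Submodule ℚ ((K i →+* ℂ) → ℚ), P ≤ antiSpan (ℂ ≃+* ℂ) (Φ i).1 →
      (∀ g : ℂ ≃+* ℂ, ∀ f ∈ P, (fun x => f (g • x)) ∈ P) →
      ∀ T : ((K i →+* ℂ) → ℚ) →ₗ[ℚ] ((K j →+* ℂ) → ℚ),
        (∀ g : ℂ ≃+* ℂ, ∀ f ∈ P, T (fun x => f (g • x)) = fun y => T f (g • y)) →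
        (∀ f ∈ P, T f ∈ antiSpan (ℂ ≃+* ℂ) (Φ j).1) → (∀ f ∈ P, T f = 0 → f = 0) → P = ⊥) :
    cmFamilyRank Φ + Fintype.card C = (∑ c, cmFamilyRank fun i : {i : I // κ i = c} => Φ i.1) + 1 :=
  typeRank_sigmaType_add_card_eq_of_pairwise_slots_fiber (G := ℂ ≃+* ℂ) (Φ := fun i => (Φ i).1)
    (fun i => isCMTypeWith_conj (Φ i)) κ hκ hpair

/-- **Nondegeneracy is decided block by block as soon as no two slots of different blocks share a constituent**:
`(Φ_i)_i` is nondegenerate iff every block sub-family `(Φ_i)_{κ i = c}` is — `∏_i A_i` is stably nondegenerate iff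
every `∏_{κ i = c} A_i` is, with nothing asked of two slots in one block.
[cite: MoonenZarhin1999LowDim, §3 (3.1)] [cite: Gordon1999HodgeAVSurvey, 7.5] -/
theorem isNondegenerateFamily_iff_forall_fiber_of_pairwise_slots [Nonempty I] (Φ : ∀ i, CMType (K i)) (κ : I → C)
    (hκ : Function.Surjective κ)
    (hpair : ∀ i j, κ i ≠ κ j → ∀ P : Submodule ℚ ((K i →+* ℂ) → ℚ), P ≤ antiSpan (ℂ ≃+* ℂ) (Φ i).1 →
      (∀ g : ℂ ≃+* ℂ, ∀ f ∈ P, (fun x => f (g • x)) ∈ P) →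
      ∀ T : ((K i →+* ℂ) → ℚ) →ₗ[ℚ] ((K j →+* ℂ) → ℚ),
        (∀ g : ℂ ≃+* ℂ, ∀ f ∈ P, T (fun x => f (g • x)) = fun y => T f (g • y)) →
        (∀ f ∈ P, T f ∈ antiSpan (ℂ ≃+* ℂ) (Φ j).1) → (∀ f ∈ P, T f = 0 → f = 0) → P = ⊥) :
    IsNondegenerateFamily Φ ↔ ∀ c, IsNondegenerateFamily fun i : {i : I // κ i = c} => Φ i.1 := by
  have key := typeRank_sigmaType_eq_iff_forall_fiber_of_pairwise_slots (G := ℂ ≃+* ℂ) (Φ := fun i => (Φ i).1)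
    (fun i => isCMTypeWith_conj (Φ i)) κ hκ hpair
  rw [isNondegenerateFamily_iff, ← card_sigma_ringHom_eq_sum_finrank₄₃ (K := K)]
  refine key.trans (forall_congr' fun c => ?_)
  rw [isNondegenerateFamily_iff, ← card_sigma_ringHom_eq_sum_finrank₄₃ (K := fun i : {i : I // κ i = c} => K i.1)]
  exact Iff.rfl

end CMAlgebra

end Literature.AlgebraicGeometry.Pohlmann1968

end
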